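import Literature.Probability.FitznerVanDerHofstad2017.NobleInstantiateFamily
import Literature.Probability.FitznerVanDerHofstad2017.NobleImprovementInputsRem
import Literature.Probability.FitznerVanDerHofstad2017.MeanFieldOfTriangle
import Literature.Barriers.CriticalPhenomena.LaceExpansionHighDimensionMeanFieldExplicit
import HarnessLib

/-!
# «The triangle condition holds for nearest-neighbour percolation in every dimension `d ≥ d₀`» as a certificate-backed `Prop`

CITATION HEADER (PLACEMENT v2). This module belongs to the certified REPRODUCTION of
R. Fitzner, R. van der Hofstad, *Mean-field behavior for nearest-neighbor percolation in `d > 10`*,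
Electron. J. Probab. 22 (2017) no. 43 [FvdH17] (Thm. 1.1: the infrared bound, hence the triangle condition,
"for nearest-neighbor percolation in `d ≥ 11`"; Thm. 1.2: separate numerical verifications at
`d = 11, 12, 13, 14, 15, 20`; §2.7: "`d = 10` … the improvement of `f₃(p)` becomes problematic"), on the analysis of
*Generalized approach to the non-backtracking lace expansion*, PTRF 169 (2017) 1041–1119 [NoBLE17] (Def. 2.9,
Prop. 2.11, Thm. 2.10; §2.5 p. 1062 and §6 p. 1104: the ASSERTION that success at `d′` gives all `d ≥ d′`).
Origin: cell `pub-lace7` (CriticalPhenomena; OBJECT → THEOREM), Lean seat 3.  PLACEMENT: the cell's own bookkeeping (not a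
printed display), hence under the lace cell topic `Summits/CriticalPhenomena/LaceExpansionHighD/` (namespace
`Summit.CriticalPhenomena.LaceExpansionHighD`, the `b2b-lace` placement rule R491);
it imports the `b2b-lace` packet's Literature modules and restates none of their declarations.

HONEST FRAMING. This file proves NOTHING analytic about the lace expansion and evaluates NO constant. It is the
bookkeeping that makes the cell's sentence «each dimension that closes is a theorem» literally true in the kernel:

* the TARGET SENTENCE `TriangleConditionFrom d₀ := ∀ d ≥ d₀, TriangleCondition d` (the tree's `TriangleCondition`,
  `Literature/Probability/Percolation/TwoPointFunction.lean`: summability of `τ_{p_c}(0,x) τ_{p_c}(x,y) τ_{p_c}(y,0)`);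
* the LADDER ALGEBRA: `TriangleConditionFrom d₀ ↔ TriangleCondition d₀ ∧ TriangleConditionFrom (d₀+1)`
  (`triangleConditionFrom_succ_iff`), windows `[d₀, D)` + a tail from `D` (`triangleConditionFrom_of_window`);
* the UNCONDITIONAL TAIL of the tree: `TriangleConditionFrom haraSladeThreshold` (`≈ 1.369·10⁴⁹`, the explicit
  threshold of the library's Hara–Slade 1990 proof, `triangleCondition_of_haraSladeThreshold_le`) and
  `TriangleConditionFrom (10 ^ 50)`;
* the CERTIFICATE-BACKED RUNG `LaceCertifiedAt d` — literally "there are constants `c_μ, c, γ, Γ` and tables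
  `Bi, Bo, bi, bo` carrying the numeric certificate `NobleNumericCertificate d …` of [NoBLE17] Def. 2.9 / Prop. 2.11
  (eleven closed inequalities, `norm_num` on literal tables) AND the two analytic binders `NobleInitialInputsAt d Bi bi`,
  `NobleImprovementInputsAt d c_μ c Γ Bo bo` of `NobleInstantiate.lean`" — with `LaceCertifiedAt.triangleCondition`
  (`d ≥ 7`, via `meanField_of_certificate`: NoBLE bound ⇒ infrared bound ⇒ triangle condition, all tree theorems), the
  same over a GENERAL finite family of weighted diagrams (`laceCertifiedAt_of_certificateOf`, `NobleInstantiateFamily.lean`)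
  and over the RE-CUT improvement oracle (`laceCertifiedAt_of_remAt`, `NobleImprovementInputsRem.lean`), so that every
  certificate shape the programme has typed lands on the same rung predicate; and the rung step
  `triangleConditionFrom_of_laceCertifiedAt : 7 ≤ d₀ → LaceCertifiedAt d₀ → TriangleConditionFrom (d₀+1) → TriangleConditionFrom d₀`;
* the MEAN-FIELD COROLLARY `TriangleConditionFrom.meanField` (`θ(p_c) = 0`, `γ = β = 1`, `δ = 2` in bounded-ratio form at
  every `d ≥ max d₀ 2`, the tree's `meanField_of_triangle`);
* the STATUS MAP of `d₀ = 11`: `triangleConditionFrom_eleven_of_window` — what "all `d ≥ 11`" costs in THIS tree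
  (a certified rung at every `11 ≤ d < haraSladeThreshold`; nothing is claimed about that window here) — and, in a
  separate final section, the printed claim taken as the tree's NAMED FACT `FitznerVanDerHofstad2017_nobleAnalysisInputs`
  (`∀ d ≥ 11`, NOT proved; CONDITIONAL link, used nowhere else in this file).

WHAT A RUNG COSTS, HONESTLY (REFEREE V1(b) of the `b2b-lace` packet, `GAPS.md` G8): in `LaceCertifiedAt d` the numeric
certificate is kernel arithmetic once the tables are numerals, but the two analytic binders then read "this numeric table IS
a valid set of [NoBLE17] Assumption-2.7 constants for percolation on `ℤ^d`" — the programme's EVALUATION of the published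
`Γ ↦ β` formulas ([NoBLE17] App. D, [FvdH17] §§3–5), not a published theorem and not kernel-proved except for the parts the
`d = 11` line has discharged (`MeanFieldD11AppDDischarged*.lean`).  A rung is therefore CONDITIONAL on exactly those binders
until they are kernel theorems; this file changes nothing about that and names the binders in every statement.
No dimension below eleven is asserted anywhere in this file; the `d = 10` declarations are SLOTS (implications from
hypotheses nobody has discharged).

## References
* [FvdH17] R. Fitzner, R. van der Hofstad, EJP 22 (2017) no. 43 — Thm. 1.1, Thm. 1.2, Cor. 1.3, Prop. 2.4, §2.5, §2.7.
* [NoBLE17] R. Fitzner, R. van der Hofstad, PTRF 169 (2017) 1041–1119 — Def. 2.9, Prop. 2.11, Thm. 2.10, §2.5, §6.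
* [HS90] T. Hara, G. Slade, Comm. Math. Phys. 128 (1990) 333–391 — Thm. 1.1 (`d ≥ d₀`).
* M. Heydenreich, R. van der Hofstad, *Progress in high-dimensional percolation and random graphs*, Springer 2017 —
  Thm. 5.1, Cor. 5.2, Thm. 4.1.
-/

noncomputable section

namespace Summit.CriticalPhenomena.LaceExpansionHighD

open Literature.Barriers.CriticalPhenomena Literature.Probability.Percolation
open Literature.Probability.LatticeModels Literature.Probability.FitznerVanDerHofstad2017

variable {d d₀ d₁ D : ℕ}

/-! ## 1. The target sentence -/

/-- **«The triangle condition holds for nearest-neighbour percolation on `ℤ^d` in every dimension `d ≥ d₀`.»**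
`TriangleConditionFrom d₀ := ∀ d ≥ d₀, TriangleCondition d`.  In print: `d₀ = 11` is [FvdH17] Thm. 1.1 (computer-assisted,
with the passage "verified at `d′` ⇒ all `d ≥ d′`" asserted in [NoBLE17] §2.5/§6); `d₀ = 19` is Hara–Slade 1994; some
inexplicit `d₀` is [HS90] Thm. 1.1.  In this tree: unconditional from `haraSladeThreshold ≈ 1.37·10⁴⁹`
(`triangleConditionFrom_haraSladeThreshold`); every smaller `d₀` is reached rung by rung (`triangleConditionFrom_succ_iff`).
[cite: FitznerVanDerHofstad2017, Thm. 1.1 and Thm. 1.2] [cite: HaraSlade1990, Thm. 1.1] -/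
def TriangleConditionFrom (d₀ : ℕ) : Prop :=
  ∀ ⦃d : ℕ⦄, d₀ ≤ d → TriangleCondition d

namespace TriangleConditionFrom

/-- The threshold dimension itself satisfies the triangle condition. [folklore] -/
theorem self (h : TriangleConditionFrom d₀) : TriangleCondition d₀ :=
  h le_rfl

/-- Raising the threshold weakens the sentence. [folklore] -/
theorem anti (h : TriangleConditionFrom d₀) (hle : d₀ ≤ d₁) : TriangleConditionFrom d₁ :=
  fun _ hd => h (hle.trans hd)

/-- In particular `TriangleConditionFrom d₀ → TriangleConditionFrom (d₀ + 1)`. [folklore] -/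
theorem succ (h : TriangleConditionFrom d₀) : TriangleConditionFrom (d₀ + 1) :=
  h.anti (Nat.le_succ d₀)

/-- **Mean-field behaviour along the whole range**: for every `d ≥ d₀` (and `d ≥ 2`), `θ(p_c) = 0`, `γ = 1`, `β = 1`,
`δ = 2` in the bounded-ratio sense — the tree's `meanField_of_triangle` (Aizenman–Newman 1984, Barsky–Aizenman 1991 via
Hutchcroft 2022, all proved in the tree). [cite: FitznerVanDerHofstad2017, Cor. 1.3] [cite: HeydenreichVanDerHofstad2017, Thm. 4.1] -/
theorem meanField (h : TriangleConditionFrom d₀) (hd₀ : 2 ≤ d₀) ⦃d : ℕ⦄ (hd : d₀ ≤ d) : MeanField d :=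
  meanField_of_triangle (hd₀.trans hd) (h hd)

/-- `θ(p_c(ℤ^d)) = 0` for every `d ≥ d₀` (`d₀ ≥ 2`). [cite: FitznerVanDerHofstad2017, Cor. 1.3] -/
theorem percolationContinuity (h : TriangleConditionFrom d₀) (hd₀ : 2 ≤ d₀) ⦃d : ℕ⦄ (hd : d₀ ≤ d) :
    PercolationContinuity d :=
  percolationContinuity_of_triangle (hd₀.trans hd) (h hd)

end TriangleConditionFrom

/-! ## 2. The ladder algebra -/

/-- **One rung**: the sentence from `d₀` is the triangle condition AT `d₀` together with the sentence from `d₀ + 1`.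
[folklore] -/
theorem triangleConditionFrom_succ_iff :
    TriangleConditionFrom d₀ ↔ TriangleCondition d₀ ∧ TriangleConditionFrom (d₀ + 1) := by
  refine ⟨fun h => ⟨h.self, h.succ⟩, fun h d hd => ?_⟩
  rcases hd.eq_or_lt with rfl | hlt
  · exact h.1
  · exact h.2 (Nat.succ_le_of_lt hlt)

/-- **Closing a rung**: the triangle condition at `d₀` lowers the threshold from `d₀ + 1` to `d₀`. [folklore] -/
theorem triangleConditionFrom_of_rung (hT : TriangleCondition d₀) (h : TriangleConditionFrom (d₀ + 1)) :
    TriangleConditionFrom d₀ :=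
  triangleConditionFrom_succ_iff.2 ⟨hT, h⟩

/-- **Window + tail**: the triangle condition at every `d` of the window `d₀ ≤ d < D` and the sentence from `D` give
the sentence from `d₀`. [folklore] -/
theorem triangleConditionFrom_of_window (hW : ∀ d, d₀ ≤ d → d < D → TriangleCondition d)
    (hD : TriangleConditionFrom D) : TriangleConditionFrom d₀ := by
  intro d hd
  rcases lt_or_ge d D with hlt | hge
  · exact hW d hd hlt
  · exact hD hge

/-- The window form is equivalent (for `d₀ ≤ D`). [folklore] -/
theorem triangleConditionFrom_iff_window (hle : d₀ ≤ D) :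
    TriangleConditionFrom d₀ ↔ (∀ d, d₀ ≤ d → d < D → TriangleCondition d) ∧ TriangleConditionFrom D :=
  ⟨fun h => ⟨fun _ hd _ => h hd, h.anti hle⟩, fun h => triangleConditionFrom_of_window h.1 h.2⟩

/-! ## 3. The unconditional tail of the tree (Hara–Slade 1990 with the library's explicit threshold) -/

/-- The explicit threshold of the library's formal Hara–Slade proof:
`4 160 000 · (275 · 5000 · (300 · (16⁴ + 1)) · 4¹³)² ≈ 1.369·10⁴⁹` (`LaceExpansionHighDimensionMeanFieldExplicit.lean`;
a property of the formalisation's un-optimised constants, NOT a printed value — [HS90] p. 339 estimates `d₀ = 48` for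
their method). [cite: HaraSlade1990, Thm. 1.1 and p. 338] -/
def haraSladeThreshold : ℕ :=
  4160000 * (275 * 5000 * (300 * (16 ^ 4 + 1)) * 4 ^ 13) ^ 2

/-- `haraSladeThreshold < 10⁵⁰`. [folklore] -/
theorem haraSladeThreshold_lt_ten_pow_fifty : haraSladeThreshold < 10 ^ 50 := by
  norm_num [haraSladeThreshold]

/-- `11 ≤ haraSladeThreshold` (so windows starting at `11`, `10`, … below the tail are non-degenerate). [folklore] -/
theorem eleven_le_haraSladeThreshold : 11 ≤ haraSladeThreshold := by
  norm_num [haraSladeThreshold]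

/-- **UNCONDITIONAL**: the triangle condition in every dimension `d ≥ haraSladeThreshold` — the tree's kernel proof of
Hara–Slade 1990 (Heydenreich–van der Hofstad 2017, Chs. 5–8) with explicit constants. No hypothesis.
[cite: HaraSlade1990, Thm. 1.1] [cite: HeydenreichVanDerHofstad2017, Thm. 5.1 and Cor. 5.2] -/
theorem triangleConditionFrom_haraSladeThreshold : TriangleConditionFrom haraSladeThreshold :=
  fun _ hd => triangleCondition_of_haraSladeThreshold_le hd

/-- **UNCONDITIONAL**, round form: the triangle condition in every dimension `d ≥ 10⁵⁰`.
[cite: HaraSlade1990, Thm. 1.1] [cite: HeydenreichVanDerHofstad2017, Thm. 5.1 and Cor. 5.2] -/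
theorem triangleConditionFrom_ten_pow_fifty : TriangleConditionFrom (10 ^ 50) :=
  triangleConditionFrom_haraSladeThreshold.anti haraSladeThreshold_lt_ten_pow_fifty.le

/-- With the tail in the tree, the sentence from ANY `d₀` is a FINITE conjunction: the triangle condition at each
`d₀ ≤ d < haraSladeThreshold`. [cite: HaraSlade1990, Thm. 1.1] -/
theorem triangleConditionFrom_of_window_haraSlade
    (hW : ∀ d, d₀ ≤ d → d < haraSladeThreshold → TriangleCondition d) : TriangleConditionFrom d₀ :=
  triangleConditionFrom_of_window hW triangleConditionFrom_haraSladeThreshold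

/-! ## 4. Certificate-backed rungs -/

/-- **A CERTIFIED RUNG at dimension `d`** (the OBJECT of the cell's object → theorem pipeline): constants
`c_μ`, `c = (c_{n,l,S})`, targets `γ < Γ` and tables `Bi, Bo : NobleBeta`, `bi, bo : Fin 6 → ℝ` such that
(i) the NUMERIC CERTIFICATE `NobleNumericCertificate d c_μ c γ Γ Bi Bo bi bo` holds — the eleven closed inequalities of
[NoBLE17] Def. 2.9 `P(γ, Γ)` / Prop. 2.11 (kernel arithmetic by `norm_num` once the tables are literals; e.g.
`D11.nobleCertificate_d11_rev14`), and (ii) the two ANALYTIC BINDERS of `NobleInstantiate.lean` hold: `NobleInitialInputsAt d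
Bi bi` (the simplified NoBLE form and the six weighted-diagram bounds at `p_I = 1/(2d-1)`) and `NobleImprovementInputsAt d
c_μ c Γ Bo bo` (the same on `(p_I, p_c)` under `f ≤ Γ`).  NOT CITABLE once the tables are numerals (the binders are then
the programme's evaluation of [NoBLE17] App. D / [FvdH17] §§3–5, `GAPS.md` G8): a proof of `LaceCertifiedAt d` is exactly
as conditional as its two binders.
[cite: FitznerVanDerHofstad2016NoBLE, Def. 2.9, Prop. 2.11, Assumption 2.7] [cite: FitznerVanDerHofstad2017, §2.5 and Figure 3] -/
def LaceCertifiedAt (d : ℕ) : Prop :=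
  ∃ (cμ : ℝ) (c : Fin 6 → ℝ) (γ Γ : Fin 3 → ℝ) (Bi Bo : NobleBeta) (bi bo : Fin 6 → ℝ),
    NobleNumericCertificate d cμ c γ Γ Bi Bo bi bo ∧ NobleInitialInputsAt d Bi bi ∧
      NobleImprovementInputsAt d cμ c Γ Bo bo

/-- Packaging a certificate and its two binders as a certified rung. [folklore] -/
theorem laceCertifiedAt_of_certificate {cμ : ℝ} {c : Fin 6 → ℝ} {γ Γ : Fin 3 → ℝ} {Bi Bo : NobleBeta}
    {bi bo : Fin 6 → ℝ} (hN : NobleNumericCertificate d cμ c γ Γ Bi Bo bi bo) (hI : NobleInitialInputsAt d Bi bi)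
    (hS : NobleImprovementInputsAt d cμ c Γ Bo bo) : LaceCertifiedAt d :=
  ⟨cμ, c, γ, Γ, Bi, Bo, bi, bo, hN, hI, hS⟩

/-- A certified rung over the RE-CUT improvement oracle of `NobleImprovementInputsRem.lean`
(`NobleImprovementInputsRemAt d CS … R B b := RemValid d CS R → NobleImprovementInputsAt …`) together with a KERNEL proof
of the validity of the remainder table `R` (e.g. `remValid_d10_cs18 : RemValid 10 18 R18`) is a certified rung.
[cite: FitznerVanDerHofstad2017, §4.2 (4.18) and Prop. 2.2] -/
theorem laceCertifiedAt_of_remAt {CS : ℕ} {cμ : ℝ} {c : Fin 6 → ℝ} {γ Γ : Fin 3 → ℝ} {R : RemRead → ℝ}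
    {Bi Bo : NobleBeta} {bi bo : Fin 6 → ℝ} (hN : NobleNumericCertificate d cμ c γ Γ Bi Bo bi bo)
    (hI : NobleInitialInputsAt d Bi bi) (hR : RemValid d CS R) (hS : NobleImprovementInputsRemAt d CS cμ c Γ R Bo bo) :
    LaceCertifiedAt d :=
  laceCertifiedAt_of_certificate hN hI (nobleImprovementInputsAt_of_remAt hR hS)

/-- A certified rung yields the raw per-dimension inputs `NobleAnalysisInputsAt d` of `NobleInstantiate.lean` (`d ≥ 2`).
[cite: FitznerVanDerHofstad2016NoBLE, Prop. 2.11] -/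
theorem LaceCertifiedAt.nobleAnalysisInputsAt (hd : 2 ≤ d) (h : LaceCertifiedAt d) : NobleAnalysisInputsAt d := by
  obtain ⟨cμ, c, γ, Γ, Bi, Bo, bi, bo, hN, hI, hS⟩ := h
  exact nobleAnalysisInputsAt_of_certificate hd hN hI hS

/-- **A certified rung at `d ≥ 7` gives the triangle condition at `d`**: NoBLE bound ⇒ infrared bound ⇒ triangle
condition (`meanField_of_certificate`; every step downstream of the two binders is a tree theorem).
[cite: FitznerVanDerHofstad2017, Thm. 1.1 and Prop. 2.4] [cite: HeydenreichVanDerHofstad2017, Cor. 5.2] -/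
theorem LaceCertifiedAt.triangleCondition (hd : 7 ≤ d) (h : LaceCertifiedAt d) : TriangleCondition d := by
  obtain ⟨cμ, c, γ, Γ, Bi, Bo, bi, bo, hN, hI, hS⟩ := h
  exact (meanField_of_certificate hd hN hI hS).1

/-- A certified rung at `d ≥ 7` gives full mean-field behaviour `MeanField d` at `d`.
[cite: FitznerVanDerHofstad2017, Cor. 1.3] -/
theorem LaceCertifiedAt.meanField (hd : 7 ≤ d) (h : LaceCertifiedAt d) : MeanField d :=
  meanField_of_triangle (le_trans (by norm_num) hd) (h.triangleCondition hd)

/-- The raw inputs at `d ≥ 7` also give the triangle condition (`meanField_of_inputsAt`), so `NobleAnalysisInputsAt d` is an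
equally good rung predicate. [cite: FitznerVanDerHofstad2017, Thm. 1.1 and Prop. 2.4] -/
theorem triangleCondition_of_nobleAnalysisInputsAt (hd : 7 ≤ d) (h : NobleAnalysisInputsAt d) : TriangleCondition d :=
  (meanField_of_inputsAt hd h).1

section Family

variable {ι : Type*} [Fintype ι] [Nonempty ι]

/-- **Rungs over a GENERAL finite family `𝒮` of weighted diagrams** (`NobleInstantiateFamily.lean`: bootstrap schemes with
more or other weighted diagrams than [FvdH17] (2.23)): a numeric certificate and the two binders over `𝒮` give the triangle
condition at `d ≥ 7` (`meanField_of_certificateOf`).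
[cite: FitznerVanDerHofstad2016NoBLE, (2.5)–(2.7) and §3.3.5] [cite: FitznerVanDerHofstad2017, Thm. 1.1] -/
theorem triangleCondition_of_certificateOf (hd : 7 ≤ d) {𝒮 : ι → ℕ × ℕ × Set (Site d)} {cμ : ℝ} {c : ι → ℝ}
    {γ Γ : Fin 3 → ℝ} {Bi Bo : NobleBeta} {bi bo : ι → ℝ} (hN : NobleNumericCertificateOf d cμ c γ Γ Bi Bo bi bo)
    (hI : NobleInitialInputsOf 𝒮 Bi bi) (hS : NobleImprovementInputsOf 𝒮 cμ c Γ Bo bo) : TriangleCondition d :=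
  (meanField_of_certificateOf hd hN hI hS).1

end Family

/-! ## 5. The ladder with certified rungs -/

/-- **Closing a rung by a certificate**: a certified rung at `d₀ ≥ 7` lowers the threshold from `d₀ + 1` to `d₀`.
This is the cell's unit of progress: "dimension `d₀` closes" = a proof of `LaceCertifiedAt d₀`.
[cite: FitznerVanDerHofstad2017, Thm. 1.1 and §2.7] -/
theorem triangleConditionFrom_of_laceCertifiedAt (hd : 7 ≤ d₀) (hC : LaceCertifiedAt d₀)
    (h : TriangleConditionFrom (d₀ + 1)) : TriangleConditionFrom d₀ :=
  triangleConditionFrom_of_rung (hC.triangleCondition hd) h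

/-- **A certified window plus a tail**: certified rungs at every `d₀ ≤ d < D` (`d₀ ≥ 7`) and the sentence from `D` give
the sentence from `d₀`. [cite: FitznerVanDerHofstad2017, Thm. 1.1 and Thm. 1.2] -/
theorem triangleConditionFrom_of_certifiedWindow (hd : 7 ≤ d₀) (hW : ∀ d, d₀ ≤ d → d < D → LaceCertifiedAt d)
    (hD : TriangleConditionFrom D) : TriangleConditionFrom d₀ :=
  triangleConditionFrom_of_window (fun d hd₀ hlt => (hW d hd₀ hlt).triangleCondition (hd.trans hd₀)) hD

/-- **STATUS MAP of "all `d ≥ 11`" in this tree**: certified rungs (equivalently raw inputs `NobleAnalysisInputsAt d`) at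
every `11 ≤ d < haraSladeThreshold` would give `TriangleConditionFrom 11`, the tail being unconditional.  Nothing about
that window is claimed here: the `b2b-lace` packet holds a `d = 11` certificate of record (`MeanFieldD11CertRev14.lean`,
conditional on its two binders) and per-`d` numerics for `12 ≤ d ≤ 3000` and boxes beyond (numerics, not tree theorems).
[cite: FitznerVanDerHofstad2017, Thm. 1.1 and Thm. 1.2] [cite: HaraSlade1990, Thm. 1.1] -/
theorem triangleConditionFrom_eleven_of_window
    (hW : ∀ d, 11 ≤ d → d < haraSladeThreshold → NobleAnalysisInputsAt d) : TriangleConditionFrom 11 :=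
  triangleConditionFrom_of_window_haraSlade fun d hd hlt =>
    triangleCondition_of_nobleAnalysisInputsAt (le_trans (by norm_num) hd) (hW d hd hlt)

/-! ## 6. The `d = 10` slots (implications only; no certificate at `d = 10` is asserted) -/

/-- **Rung `d = 10` (slot)**: a certified rung at `d = 10` and the sentence from `11` give the sentence from `10`.
[FvdH17] §2.7 reports that with the printed bounds the `f₃`-improvement fails at `d = 10`.
[cite: FitznerVanDerHofstad2017, §2.7] -/
theorem triangleConditionFrom_ten_of (hC : LaceCertifiedAt 10) (h11 : TriangleConditionFrom 11) :
    TriangleConditionFrom 10 :=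
  triangleConditionFrom_of_laceCertifiedAt (by norm_num) hC h11

/-- **Rung `d = 10` over the re-cut oracle (slot)**: the kernel theorem `remValid_d10_cs18 : RemValid 10 18 R18`
(`RemValidD10CS18.lean`) is in the tree, so at `d = 10` a numeric certificate, the initial-point binder and the RE-CUT
improvement binder at the table `R18` already make a certified rung.  No such certificate is asserted here.
[cite: FitznerVanDerHofstad2017, §2.7 and §4.2 (4.18)] -/
theorem laceCertifiedAt_ten_of_remAt {cμ : ℝ} {c : Fin 6 → ℝ} {γ Γ : Fin 3 → ℝ} {R : RemRead → ℝ}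
    {Bi Bo : NobleBeta} {bi bo : Fin 6 → ℝ} (hN : NobleNumericCertificate 10 cμ c γ Γ Bi Bo bi bo)
    (hI : NobleInitialInputsAt 10 Bi bi) (hR : RemValid 10 18 R) (hS : NobleImprovementInputsRemAt 10 18 cμ c Γ R Bo bo) :
    LaceCertifiedAt 10 :=
  laceCertifiedAt_of_remAt hN hI hR hS

/-! ## 7. The printed claim, taken as the tree's named fact (CONDITIONAL link; used nowhere else in this file) -/

/-- **[FvdH17] Thm. 1.1 as filed in the tree**: the named fact `FitznerVanDerHofstad2017_nobleAnalysisInputs`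
(`∀ d ≥ 11`, the raw inputs of the NoBLE analysis — NOT proved in the tree; its body at one `d` is word for word
`NobleAnalysisInputsAt d`) gives `TriangleConditionFrom 11`.  CONDITIONAL on that named fact; recorded here only to
place the printed claim on the same `Prop` as the kernel tail and the certified rungs.
[cite: FitznerVanDerHofstad2017, Thm. 1.1 and Prop. 2.4] -/
theorem triangleConditionFrom_eleven_of_fact (h : FitznerVanDerHofstad2017_nobleAnalysisInputs) :
    TriangleConditionFrom 11 :=
  fun d hd => triangleCondition_of_nobleAnalysisInputsAt (le_trans (by norm_num) hd) (h d hd)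

end Summit.CriticalPhenomena.LaceExpansionHighD

end
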